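import Summits.CriticalPhenomena.PercolationContinuityZ3.Theorems.Transplant.BoxProdZ2Defs
import Summits.CriticalPhenomena.PercolationContinuityZ3.Theorems.Transplant.ProdSymmetry
import Literature.Barriers.CriticalPhenomena.SubexponentialGrowthZdBurtonKeane
import Literature.Probability.Percolation.SeedLemma
import HarnessLib

/-!
# Interface Φ0 (general form) — planar skeletons, their cylinders and prisms, the lane's named missing theorem
# `SamePWitnessOfSkeleton`, and the conditional continuity corollary; instance: every `X □ ℤ²`

builds on p205010 (kernel theorem, internal audit signed; external expert review pending).
Status sentence (coordinator 2026-08-20T04:30Z): "θ(p_c) = 0 on ℤ^d, all d ≥ 2 — kernel-verified (Lean 4/Mathlib,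
standard axioms); internal adversarial audit SIGNED 2026-08-20 04:29Z; external expert review pending."

Lane `prim-bschramm`, design `LADDER.md` v4 / `BLUEPRINT-I-PHI.md` §0–§7 (refereed ×5; a DESIGN, NOT a theorem),
seat `prim-bschramm-lead` (packaging on behalf of the ended seat p4).  A **planar skeleton** of a graph `G` is a
sup-norm 1-Lipschitz map `φ : V → ℤ²` together with (i) finitely many base vertices, (ii) FRAMES — every vertex is
the image of a base vertex under an automorphism of `G` that TRANSLATES `φ`, and (iii) a POINT GROUP — at every
base vertex the hyperoctahedral group `HOct 2` (the dihedral group `D₄` of the square lattice) lifts to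
automorphisms of `G` fixing the base vertex and acting on `φ` linearly.  The CYLINDER of half-width `ℓ` at `t`
is `φ⁻¹(φ t + {-ℓ,…,ℓ}²)` (all fibres over a skeleton box); the PRISM adds the graph-ball cut-off in `G`
(finite for locally finite `G`, automatically frame- and point-group-equivariant).

* `PlanarSkeleton G` (structure), `PlanarSkeleton.cyl`, `PlanarSkeleton.prism`, `PlanarSkeleton.CylSubcritical`
  (no cylinder percolates at density `p` — input Φ2; discharged in the tree for the Heisenberg group by bounded
  cutsets, p208219, for fcc/bcc by `theta_eq_zero_of_lipschitzHeight`, and for products by Martineau–Severo, p208012);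
* `SamePWitnessOfSkeleton` — THE NAMED MISSING THEOREM of the lane in general form (`@[conjecture]`, never
  asserted): Kozma–Nitzan §4 re-typed in skeleton coordinates, producing p4's same-`p` witness from uniqueness of
  the infinite cluster, cylinder-subcriticality and `θ > 0` at the same density;
* `continuity_of_skeleton` / `continuity_of_skeleton_amenable` — the conditional corollary: the named theorem +
  cylinders at `p_c` (+ uniqueness at `p_c`, automatic on connected quasi-transitive AMENABLE graphs by the tree's
  proved Burton–Keane theorem `BurtonKeane1989_atMostOneInfiniteCluster_holds`) give `θ_t(p_c) = 0`
  (continuation principle `SameP.criticalProb_lt_of_lawful`, p207164, at the single density `p_c`);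
* `boxProdZ2Skeleton` — every `X □ ℤ²` with `X` quasi-transitive carries a planar skeleton (`φ = Prod.snd`, frames =
  p2's `prodFrameIso`, point group = p2's `prodHOctIso`), and its cylinders are the tubes of `BoxProdZ2Defs`
  (`cyl_boxProdZ2Skeleton`), so `CylSubcritical` there is `BoxProdZ2.TubeSubcritical` restricted to base roots.
[cite: KozmaNitzan2024, §1 p. 2 (approach 1); §4 pp. 15–31] [cite: BenjaminiSchramm1996, Conj. 4]
[cite: LyonsPeres2016, Thm. 7.6] [cite: MartineauSevero2019, Cor. 2.2]
-/

noncomputable section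

namespace Summit.CriticalPhenomena.PercolationContinuityZ3.Theorems.Transplant

open MeasureTheory Literature.Probability.Percolation Literature.Probability.LatticeModels
open Literature.Probability.Percolation.GM
open Literature.Barriers.CriticalPhenomena (IsQuasiTransitive IsGraphAmenable graphBall graphBall_finite
  BurtonKeane1989_atMostOneInfiniteCluster_holds)

/-- **Planar skeleton** of a graph (lane design LADDER v4, input Φ): a sup-norm 1-Lipschitz map to `ℤ²` with
finitely many base vertices, translating frames and a lifted point group `HOct 2` at each base vertex.
[cite: KozmaNitzan2024, §4 p. 15 (the role of the symmetries of ℤ^d)] -/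
structure PlanarSkeleton {V : Type} (G : SimpleGraph V) where
  /-- the skeleton map `φ : V → ℤ²` -/
  φ : V → Site 2
  /-- `φ` is 1-Lipschitz in the sup-norm along edges -/
  lip : ∀ ⦃u v : V⦄, G.Adj u v → ∀ i : Fin 2, |φ u i - φ v i| ≤ 1
  /-- finitely many base vertices (one per frame type) -/
  types : Finset V
  /-- FRAMES: every vertex is the image of a base vertex under an automorphism translating the skeleton -/
  frame : ∀ v : V, ∃ t ∈ types, ∃ α : G ≃g G, α t = v ∧ ∀ w, φ (α w) = φ w + (φ v - φ t)
  /-- POINT GROUP: at each base vertex, `HOct 2` lifts to automorphisms fixing it and acting linearly on `φ` -/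
  point : ∀ t ∈ types, ∀ g : HOct 2, ∃ α : G ≃g G, α t = t ∧ ∀ w, φ (α w) - φ t = sp g (φ w - φ t)

namespace PlanarSkeleton

variable {V : Type} {G : SimpleGraph V} (Φ : PlanarSkeleton G)

/-- **Cylinder** of half-width `ℓ` at `t`: all vertices whose skeleton coordinate lies in the box `φ t + {-ℓ,…,ℓ}²`.
[cite: KozmaNitzan2024, §4 p. 15 (boxes)] -/
def cyl (t : V) (ℓ : ℕ) : Set V := {w | Φ.φ w - Φ.φ t ∈ box 2 ℓ}

/-- Membership in a cylinder. [folklore] -/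
@[simp] theorem mem_cyl (t : V) (ℓ : ℕ) (w : V) : w ∈ Φ.cyl t ℓ ↔ Φ.φ w - Φ.φ t ∈ box 2 ℓ := Iff.rfl

/-- The centre lies in its cylinders. [folklore] -/
theorem mem_cyl_self (t : V) (ℓ : ℕ) : t ∈ Φ.cyl t ℓ := by
  rw [mem_cyl, sub_self]; exact zero_mem_box 2 ℓ

/-- **Prism** (macro-box of the skeleton re-typing): the cylinder cut off at graph distance `R` from its centre.
[cite: KozmaNitzan2024, §4 p. 15 (boxes)] -/
def prism (t : V) (R ℓ : ℕ) : Set V := {w | w ∈ graphBall G t R ∧ Φ.φ w - Φ.φ t ∈ box 2 ℓ}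

/-- Membership in a prism. [folklore] -/
@[simp] theorem mem_prism (t : V) (R ℓ : ℕ) (w : V) :
    w ∈ Φ.prism t R ℓ ↔ w ∈ graphBall G t R ∧ Φ.φ w - Φ.φ t ∈ box 2 ℓ := Iff.rfl

/-- Prisms lie in the cylinder of the same half-width. [folklore] -/
theorem prism_subset_cyl (t : V) (R ℓ : ℕ) : Φ.prism t R ℓ ⊆ Φ.cyl t ℓ := fun _ hw => hw.2

/-- Prisms are finite in a locally finite graph. [folklore] -/
theorem prism_finite [G.LocallyFinite] (t : V) (R ℓ : ℕ) : (Φ.prism t R ℓ).Finite :=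
  (graphBall_finite G t R).subset fun _ hw => hw.1

/-- **Input Φ2 at density `p`: no cylinder over a bounded skeleton box percolates** (Bernoulli bond percolation
on the INDUCED graph of each cylinder at a base vertex has `θ = 0` at `p`). [cite: MartineauSevero2019, Cor. 2.2] -/
def CylSubcritical (p : unitInterval) : Prop :=
  ∀ t ∈ Φ.types, ∀ ℓ : ℕ, theta (G.induce (Φ.cyl t ℓ)) ⟨t, Φ.mem_cyl_self t ℓ⟩ p = 0

end PlanarSkeleton

/-- **THE NAMED MISSING THEOREM OF THE LANE (general form)** — Kozma–Nitzan §4 re-typed in skeleton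
coordinates: on a connected, locally finite graph with a planar skeleton, at every density `p` at which the
infinite cluster is a.s. unique, no cylinder percolates and `θ_t(p) > 0` at a base vertex `t`, there is a
same-`p` witness at `t` (p4's `SameP.SamePWitnessAt`).  NOT in print, NOT proved, never asserted
(design `BLUEPRINT-I-PHI.md`; product form `BoxProdZ2.SamePWitnessBoxProdZ2` first).  AdditiveGluing is not a
hypothesis: it is proved in the tree (p205010, status sentence above).
[cite: KozmaNitzan2024, §4 pp. 15–31] [cite: BenjaminiSchramm1996, Conj. 4] -/
@[conjecture] def SamePWitnessOfSkeleton : Prop :=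
  ∀ {V : Type} [DecidableEq V] [Countable V] (G : SimpleGraph V) [G.LocallyFinite] (Φ : PlanarSkeleton G),
    G.Connected → ∀ t ∈ Φ.types, ∀ p : unitInterval,
      (∀ᵐ ω ∂bondPercolation G p, numInfiniteClusters ω ≤ 1) → Φ.CylSubcritical p → 0 < theta G t p →
        SameP.SamePWitnessAt G t p

/-- **Conditional continuity from a planar skeleton**: the named theorem, uniqueness at `p_c` and cylinders at
`p_c` give `θ_t(p_c) = 0` at every base vertex (continuation principle at the single density `p_c`).
[cite: KozmaNitzan2024, §1 p. 2 (approach 1)] -/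
theorem continuity_of_skeleton (hW : SamePWitnessOfSkeleton) {V : Type} [DecidableEq V] [Countable V]
    (G : SimpleGraph V) [G.LocallyFinite] (Φ : PlanarSkeleton G) (hc : G.Connected) (t : V) (ht : t ∈ Φ.types)
    (hU : ∀ᵐ ω ∂bondPercolation G (criticalProbIOf G t), numInfiniteClusters ω ≤ 1)
    (hC : Φ.CylSubcritical (criticalProbIOf G t)) : theta G t (criticalProbIOf G t) = 0 :=
  SameP.theta_criticalProbIOf_eq_zero_of_samePWitnessAt G t fun hpos => hW G Φ hc t ht _ hU hC hpos

/-- **… on connected, locally finite, quasi-transitive AMENABLE graphs** uniqueness is the tree's proved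
Burton–Keane theorem, so the named theorem + cylinders at `p_c` give `θ_t(p_c) = 0` — the open residue of
Benjamini–Schramm's Conjecture 4 (the non-amenable case is BLPS 1999 / Hutchcroft 2016) for every graph carrying
a planar skeleton with subcritical cylinders. [cite: BenjaminiSchramm1996, Conj. 4] [cite: LyonsPeres2016, Thm. 7.6] -/
theorem continuity_of_skeleton_amenable (hW : SamePWitnessOfSkeleton) {V : Type} [DecidableEq V]
    (G : SimpleGraph V) [G.LocallyFinite] (Φ : PlanarSkeleton G) (hc : G.Connected) (hq : IsQuasiTransitive G)
    (ha : IsGraphAmenable G) (t : V) (ht : t ∈ Φ.types) (hC : Φ.CylSubcritical (criticalProbIOf G t)) :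
    theta G t (criticalProbIOf G t) = 0 :=
  haveI : Countable V := Literature.Barriers.CriticalPhenomena.countable_of_connected_of_locallyFinite G hc t
  continuity_of_skeleton hW G Φ hc t ht (BurtonKeane1989_atMostOneInfiniteCluster_holds G hc hq ha _) hC

/-! ## Instance: every `X □ ℤ²` (`X` quasi-transitive) carries a planar skeleton, `φ = Prod.snd` -/

section BoxProd

variable {W : Type} [DecidableEq W] (X : SimpleGraph W)

omit [DecidableEq W] in
/-- Along an edge of `X □ ℤ²` the `ℤ²`-coordinate moves by at most one in each coordinate. [folklore] -/
theorem abs_snd_sub_snd_le_one {u v : W × Site 2} (h : (X □ zdGraph 2).Adj u v) (i : Fin 2) :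
    |u.2 i - v.2 i| ≤ 1 := by
  rcases SimpleGraph.boxProd_adj.1 h with ⟨_, h2⟩ | ⟨h2, _⟩
  · rw [h2, sub_self, abs_zero]; exact zero_le_one
  · obtain ⟨j, hj | hj⟩ := (zdGraph_adj_iff _ _).1 h2
    · rw [hj]
      by_cases hij : i = j
      · subst hij; simp
      · simp [hij]
    · rw [hj]
      by_cases hij : i = j
      · subst hij; simp
      · simp [hij]

/-- **The product skeleton**: `φ = Prod.snd`, base vertices `V₀ × {0}` for a quasi-transitivity witness `V₀` of `X`,
frames `(w,t) ↦ (ψ w, t + v)` (p2's `prodFrameIso`), point group `(w,t) ↦ (w, sp g t)` (p2's `prodHOctIso`).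
[cite: BenjaminiSchramm1996, §2 (almost transitive graphs)] -/
def boxProdZ2Skeleton (hq : IsQuasiTransitive X) : PlanarSkeleton (X □ zdGraph 2) where
  φ := Prod.snd
  lip := fun _ _ h i => abs_snd_sub_snd_le_one X h i
  types := (Classical.choose hq).image fun w => (w, (0 : Site 2))
  frame := by
    classical
    intro v
    obtain ⟨γ, hγ⟩ := Classical.choose_spec hq v.1
    refine ⟨(γ v.1, 0), Finset.mem_image.2 ⟨γ v.1, hγ, rfl⟩, prodFrameIso X γ.symm v.2, ?_, fun w => ?_⟩
    · rw [prodFrameIso_apply]; simp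
    · rw [prodFrameIso_apply]; simp
  point := by
    classical
    intro t ht g
    obtain ⟨w, _, rfl⟩ := Finset.mem_image.1 ht
    refine ⟨prodHOctIso X g, ?_, fun x => ?_⟩
    · rw [prodHOctIso_apply]
      simp only [Prod.mk.injEq, true_and]
      exact Site.signedPerm_zero g.1 g.2
    · rw [prodHOctIso_apply]; simp

/-- The cylinders of the product skeleton at a base root `(w, 0)` are the tubes of `BoxProdZ2Defs`. [folklore] -/
theorem cyl_boxProdZ2Skeleton (hq : IsQuasiTransitive X) (w : W) (ℓ : ℕ) :
    (boxProdZ2Skeleton X hq).cyl (w, (0 : Site 2)) ℓ = BoxProdZ2.tube W ℓ := by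
  ext v
  simp [PlanarSkeleton.cyl, boxProdZ2Skeleton, BoxProdZ2.tube]

end BoxProd

end Summit.CriticalPhenomena.PercolationContinuityZ3.Theorems.Transplant

end
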